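import Mathlib

/-!
# STUB-IDEAS k1 (gen 11) — «FINITE PARTS ARE ANCHOR-RIGID» — kernel-checked helper lemmas

Crux `PrintCf2.SplitBadTwoLowerHalfOfFacts` (stmt-BirchSwinnertonDyer-27851), stub `stub_heegnerIndexLowerAtTwo`
(child skeleton `Lines/heegner_index_two_lower.lean`).  Technique family: weaken / strengthen.

The lever.  On the anchor road (T1-AT, k1-g7) every FINITE object of the control diagram — the eigen-submodule
`X[T − a]` of the restricted dual datum, the inflation kernel `H¹(Γ, M(ε)^{G_{K_∞}})`, the finite local modules —
is RIGID on the 2-adic ball of twists `{a : #F ∣ a}`: it literally EQUALS its value at `T = 0`.  Hence the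
finite defect of the exact twisted Euler characteristic at the anchor `a_N = u^{2^N} − 1` (`v₂ a_N = N + 2`)
is the SAME integer `f₀ = v₂ #𝔖_Γ` that the parent's landed four-term identity already carries, and the LOWER
inequality needs neither «no finite Λ-submodule» (brick B17 ⟸ H²(Γ_K, W*) = 0 ∧ base lift, unproved) nor the
cokernel half of twisted control at the additive place.

All lemmas below are Mathlib-only and sorry-free.  BSD is NOT proved by any of this.
-/

set_option linter.dupNamespace false

namespace Summit.BirchSwinnertonDyer.BirchSwinnertonDyer.Cruxes.SplitBadTwoLowerHalfOfFacts.StubIdeasK1G11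

open Submodule

section FiniteRigidity

variable {R M : Type*} [CommRing R] [AddCommGroup M] [Module R M]

/-- H1.  A finite submodule is killed by (the image in `R` of) its cardinality. -/
theorem natCard_smul_eq_zero (F : Submodule R M) [Finite F] {x : M} (hx : x ∈ F) :
    (Nat.card F : R) • x = 0 := by
  have h : Nat.card F • (⟨x, hx⟩ : F) = 0 := card_nsmul_eq_zero'
  have h' : Nat.card F • x = 0 := by
    have := congrArg Subtype.val h
    simpa using this
  rw [Nat.cast_smul_eq_nsmul]
  exact h'

/-- H1'.  Hence by every multiple of its cardinality. -/
theorem smul_eq_zero_of_natCard_dvd (F : Submodule R M) [Finite F] {c : R}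
    (hc : (Nat.card F : R) ∣ c) {x : M} (hx : x ∈ F) : c • x = 0 := by
  obtain ⟨r, rfl⟩ := hc
  rw [mul_smul]
  exact natCard_smul_eq_zero F (F.smul_mem r hx)

/-- H1''.  Whole-module form (for the Galois half: a finite Galois module). -/
theorem natCard_smul_eq_zero_top [Finite M] (x : M) : (Nat.card M : R) • x = 0 := by
  rw [Nat.cast_smul_eq_nsmul]
  exact card_nsmul_eq_zero'

/-- H2.  RIGIDITY OF EIGEN-SUBMODULES UNDER CONGRUENCE.  If `a − b` kills both `M[t − a]` and `M[t − b]`,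
the two eigen-submodules coincide (as submodules, not merely in cardinality). -/
theorem torsionBy_sub_eq_of_smul_eq_zero {t a b : R}
    (hA : ∀ x ∈ torsionBy R M (t - a), (a - b) • x = 0)
    (hB : ∀ x ∈ torsionBy R M (t - b), (a - b) • x = 0) :
    torsionBy R M (t - a) = torsionBy R M (t - b) := by
  ext x
  rw [mem_torsionBy_iff, mem_torsionBy_iff]
  constructor
  · intro h
    have h' := hA x ((mem_torsionBy_iff _ _).2 h)
    have : (t - b) • x = (t - a) • x + (a - b) • x := by
      rw [← add_smul]; congr 1; ring
    rw [this, h, h', add_zero]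
  · intro h
    have h' := hB x ((mem_torsionBy_iff _ _).2 h)
    have : (t - a) • x = (t - b) • x - (a - b) • x := by
      rw [← sub_smul]; congr 1; ring
    rw [this, h, h', sub_zero]

/-- H3.  «THE FINITE PART TRANSPORTS» — usable form.  If both eigen-submodules are finite (on the route:
`H(a) ≠ 0` and `H(b) ≠ 0`, Greenberg 1999 Lemma 4.2) and `a ≡ b` modulo the product of their orders, they are
EQUAL.  At the anchors: `t = T`, `b = 0`, `a = a_N = u^{2^N} − 1` with `v₂ a_N = N + 2`. -/
theorem torsionBy_sub_eq_of_finite {t a b : R}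
    [Finite (torsionBy R M (t - a))] [Finite (torsionBy R M (t - b))]
    (h : ((Nat.card (torsionBy R M (t - a)) * Nat.card (torsionBy R M (t - b)) : ℕ) : R) ∣ a - b) :
    torsionBy R M (t - a) = torsionBy R M (t - b) := by
  apply torsionBy_sub_eq_of_smul_eq_zero
  · intro x hx
    refine smul_eq_zero_of_natCard_dvd (torsionBy R M (t - a)) ?_ hx
    exact dvd_trans ⟨_, by push_cast; rfl⟩ h
  · intro x hx
    refine smul_eq_zero_of_natCard_dvd (torsionBy R M (t - b)) ?_ hx
    exact dvd_trans ⟨(Nat.card (torsionBy R M (t - a)) : R), by push_cast; ring⟩ h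

/-- H3'.  `p`-power form: both orders divide `p ^ k` and `p ^ k ∣ a − b` (anchors: `p = 2`, `k ≤ N + 2`). -/
theorem torsionBy_sub_eq_of_card_dvd_pow {t a b : R} {p k : ℕ}
    [Finite (torsionBy R M (t - a))] [Finite (torsionBy R M (t - b))]
    (hA : Nat.card (torsionBy R M (t - a)) ∣ p ^ k) (hB : Nat.card (torsionBy R M (t - b)) ∣ p ^ k)
    (h : ((p ^ k : ℕ) : R) ∣ a - b) :
    torsionBy R M (t - a) = torsionBy R M (t - b) := by
  apply torsionBy_sub_eq_of_smul_eq_zero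
  · intro x hx
    exact smul_eq_zero_of_natCard_dvd _ ((Nat.cast_dvd_cast hA).trans h) hx
  · intro x hx
    exact smul_eq_zero_of_natCard_dvd _ ((Nat.cast_dvd_cast hB).trans h) hx

/-- H4.  THE GALOIS HALF.  On a module killed by `u − 1`, the twisted operator `u•φ − 1` IS `φ − 1`:
invariants `H⁰` (kernel) and coinvariants `H¹(Γ, ·)` (cokernel) of a finite Galois module are rigid under a
twist `ε ≡ 1 (mod exponent)`.  Route use: `#ker(res_ε) = #H¹(Γ, W*(K*_∞)(ε_N)) = #H¹(Γ, W*(K*_∞)) = 2`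
(landed `natCard_ker_resOfLe_top_of_frame_eq_two`) for `N + 2 ≥ exponent`. -/
theorem twist_sub_id_eq {u : R} (φ : M →ₗ[R] M) (hu : ∀ x : M, (u - 1) • x = 0) :
    u • φ - LinearMap.id = φ - LinearMap.id := by
  ext x
  simp only [LinearMap.sub_apply, LinearMap.smul_apply, LinearMap.id_apply]
  have h := hu (φ x)
  rw [sub_smul, one_smul, sub_eq_zero] at h
  rw [h]

theorem twist_sub_id_eq_of_natCard_dvd [Finite M] {a : R} (φ : M →ₗ[R] M)
    (ha : (Nat.card M : R) ∣ a) :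
    (1 + a) • φ - LinearMap.id = φ - LinearMap.id := by
  apply twist_sub_id_eq
  intro x
  rw [add_sub_cancel_left]
  obtain ⟨r, rfl⟩ := ha
  rw [mul_comm, mul_smul, natCard_smul_eq_zero_top, smul_zero]

/-- H4'.  Consequently the twisted invariants and coinvariants are the untwisted ones. -/
theorem ker_twist_eq_of_natCard_dvd [Finite M] {a : R} (φ : M →ₗ[R] M) (ha : (Nat.card M : R) ∣ a) :
    LinearMap.ker ((1 + a) • φ - LinearMap.id) = LinearMap.ker (φ - LinearMap.id) ∧
      LinearMap.range ((1 + a) • φ - LinearMap.id) = LinearMap.range (φ - LinearMap.id) := by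
  rw [twist_sub_id_eq_of_natCard_dvd φ ha]; exact ⟨rfl, rfl⟩

end FiniteRigidity

section OneSidedControl

/-- H5.  ONE-SIDED CONTROL COUNT (the only half of twisted control LOWER consumes): for any homomorphism of
abelian groups with finite source, `#S ∣ #ker f · #Q` — no surjectivity / cokernel / local-condition input. -/
theorem natCard_dvd_card_ker_mul {S Q : Type*} [AddCommGroup S] [AddCommGroup Q] [Finite S]
    (f : S →+ Q) : Nat.card S ∣ Nat.card f.ker * Nat.card Q := by
  have h1 : Nat.card S = Nat.card f.ker * Nat.card f.range := by
    rw [← Nat.card_congr (QuotientAddGroup.quotientKerEquivRange f).toEquiv, mul_comm]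
    exact AddSubgroup.card_eq_card_quotient_mul_card_addSubgroup f.ker
  rw [h1]
  exact mul_dvd_mul_left _ (AddSubgroup.card_addSubgroup_dvd_card f.range)

/-- H5'.  Valuation form. -/
theorem padicValNat_card_le_ker_add {S Q : Type*} [AddCommGroup S] [AddCommGroup Q] [Finite S] [Finite Q]
    (p : ℕ) [hp : Fact p.Prime] (f : S →+ Q) :
    padicValNat p (Nat.card S) ≤ padicValNat p (Nat.card f.ker) + padicValNat p (Nat.card Q) := by
  have hS : Nat.card S ≠ 0 := Nat.card_pos.ne'
  have hK : Nat.card f.ker ≠ 0 := Nat.card_pos.ne'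
  have hQ : Nat.card Q ≠ 0 := Nat.card_pos.ne'
  have hdvd := natCard_dvd_card_ker_mul f
  rw [← padicValNat.mul hK hQ]
  have hKQ : Nat.card f.ker * Nat.card Q ≠ 0 := mul_ne_zero hK hQ
  exact (padicValNat_dvd_iff_le hKQ).1 (((padicValNat_dvd_iff_le hS).2 le_rfl).trans hdvd)

end OneSidedControl

section Absorption

/-- H6.  THE WIRING (letters of k1-g7 `lower_chain_of_anchor` + the parent's four-term identity).
LOWER at `p = 2` on the split-bad branch from: the one-sided anchor TNC (`hR3`, research input R3⁻),
ONE-SIDED control (`hctrl`, H5), the EXACT twisted Euler characteristic with its finite term (`hEC`, R88 with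
`X[T − a]` kept), k1-g7's transport of `ord H` (`htr`), FINITE RIGIDITY of the two finite terms (`hf`, `hk`:
H3/H4), and the parent's LANDED four-term identity at `T = 0` (`hfour`:
`n + v₂#𝔖_Γ + v₂#ker = v₂#𝔖_{v̄}(K₀,W*) + v₂ relIndex`).  No «no finite submodule», no cokernel. -/
theorem lower_of_rigid_anchor {m n eM cA s q h f k f₀ k₀ S R : ℤ}
    (hR3 : m ≤ 2 * (s + cA) + eM)
    (hctrl : s ≤ k + q)
    (hEC : q = h + f)
    (htr : h = n)
    (hf : f = f₀) (hk : k = k₀)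
    (hfour : n + f₀ + k₀ = S + R) :
    m ≤ 2 * (S + R) + eM + 2 * cA := by
  omega

/-- H6'.  Contrast (why rigidity, not a crude bound, is the right weakening): with only `f ≤ F` (size of the
maximal finite submodule) the chain loses `2 (F − f₀)`, which no later step recovers. -/
theorem lower_of_crude_bound {m n eM cA s q h f k F k₀ f₀ S R : ℤ}
    (hR3 : m ≤ 2 * (s + cA) + eM) (hctrl : s ≤ k + q) (hEC : q = h + f) (htr : h = n)
    (hf : f ≤ F) (hk : k = k₀) (hfour : n + f₀ + k₀ = S + R) :
    m ≤ 2 * (S + R) + eM + 2 * cA + 2 * (F - f₀) := by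
  omega

/-- H6''.  With the one residual finite digit displayed: if the twisted INTERSECTION digit `k` exceeds its
`T = 0` value `k₀` by a drift `δ` (PLAN 3 predicts `δ = 0`; in any case `δ ∈ {0, 1}` and it is a keyed,
decidable currency row), LOWER holds with `2 δ` booked explicitly. -/
theorem lower_of_rigid_anchor_drift {m n eM cA s q h f k f₀ k₀ δ S R : ℤ}
    (hR3 : m ≤ 2 * (s + cA) + eM) (hctrl : s ≤ k + q) (hEC : q = h + f) (htr : h = n)
    (hf : f = f₀) (hk : k ≤ k₀ + δ) (hfour : n + f₀ + k₀ = S + R) :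
    m ≤ 2 * (S + R) + eM + 2 * cA + 2 * δ := by
  omega

end Absorption

end Summit.BirchSwinnertonDyer.BirchSwinnertonDyer.Cruxes.SplitBadTwoLowerHalfOfFacts.StubIdeasK1G11
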